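import Literature.MathematicalPhysics.QuantumFieldTheory.Balaban1983to89.B4Ineq110WalkRoute

/-!
# `Balaban1983to89.B4Ineq110WalkRouteDeriv` — [Balaban1983RegularityDecay] THEOREM (1.10), DERIVATIVE member
# «|(D^η_{A,μ}G_k(Ω,A)f)(x)| ≤ c₀exp(−δ₀dist(x, supp f))‖f‖_∞», BY THE PRINTED §2 WALK ROUTE END TO END on the
# concrete operators, for EVERY region and EVERY configuration, modulo the per-cube sup inputs

statement-level skeleton of published theorems with citation tags; proofs where landed; nothing here is a claim about the Yang–Mills mass gap

CITATION HEADER.  T. Bałaban, *Regularity and decay of lattice Green's functions*, Commun. Math. Phys. **89** (1983)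
571–597, doi:10.1007/bf01214744 [Balaban1983RegularityDecay] (cell paper B4; held text
`paper:balaban1983-cmp89-regularity-decay`, journal page = PDF page + 570; pp. 572–573, 576–579).  Unit `lit-balaban-r01`
gen 5 (B4 fold owner), HOME `run/shared/lean/pub/lit-balaban/`, SKELETON rows **B4.Thm@573** ((1.9)–(1.12); this file:
the derivative member of (1.10)), **B4.Eq2.12**, **B4.Eq2.18**.  Theorems only; imports `B4Ineq110WalkRoute` (value
member, `mulH` plumbing, `norm_le_of_neumann`).  Norm: Mathlib's scope `Matrix.Norms.Operator` (`ℓ^∞ → ℓ^∞` operator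
norm over sites AND colours).

WHAT IS PRINTED (verbatim, p. 573).  *«Similarly |(D^η_{A,μ}G_k(Ω,A)f)(x)|, |(G_k(Ω,A)f)(x)| ≤
c₀exp(−δ₀dist(x, supp f))‖f‖_∞ (1.10) for x ∈ Ω, dist(x, Ω^c) ≥ R₀. … For some simple sets Ω, e.g. for rectangular
parallelepipeds, the inequalities hold without any restrictions on the points x, x′»*; p. 572 (1.3) the covariant bond
difference `U(A_b)φ(b₊) − φ(b₋)` (`B4GaugeCovariance.bondDiff`; here placed at the site `x` as the square operator
`P_b = E_{xy}[W(x,y)] − E_{xx}[1]`, `B4GaugeCovariance.unitOp`).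

WHAT THIS MODULE PROVES (all in full).
* §2: `unitOp_apply`, `unitOp_mul_mulH` (`E_{xy}[B]·h = h(y)E_{xy}[B]`), `norm_unitOp_le` (`‖E_{xy}[B]‖ ≤` max row
  `ℓ¹`-norm of `B`), `fld_bondOp_mulVec` (`(P_bΦ)(x) = W(x,y)φ(y) − φ(x)`).
* **`ineq110_deriv`** — for [B4]'s concrete operators (as in `B4Ineq110WalkRoute.ineq110_value`), a bond `b = ⟨x,y⟩`
  with `|x − y|_∞ ≤ M/8`, `w ≥` the row `ℓ¹`-norms of `W(x,y)` (`w = 1` for `N = 1`), and the per-cube inputs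
  `γ ≥ ‖G_j‖`, `γ' ≥ ‖P_bG_j‖` (Lemma 2.2 (2.17) at `p = q = ∞`, values and covariant derivatives), `β ≥ ‖K_jG_jh_j‖`
  with (2.21) `3^dβ ≤ e⁻¹`: for every site set `F` and every `D ≤ dist_∞(x, F)`,
  `‖P_b·G_k(Ω,A)·1_F‖ ≤ 2^{d+2}e^{19/8}(γ' + (1 + w)γ)·e^{−D/M}`.  Far from `F` (`D ≥ (19/8)M`): the walk bound
  `B4Eq212SmallR.concrete_walk_decay_exp` with `P = P_b` — at most `2^{d+1}` starting cubes (those seeing `x` or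
  `y`), `‖P_b·h_jG_jh_j‖ ≤ γ' + wγ` from `P_b·h_j = h_j(x)P_b + (h_j(y) − h_j(x))E_{xy}[W]`, separation
  `⌊D/M − 11/8⌋`; near `F`: `‖P_b‖‖G‖ ≤ (1 + w)2^{d+1}γ` by `norm_le_of_neumann`.
* **`ineq110_deriv_apply`** — the printed shape: for `f` supported in `F`, `sup|f| ≤ φ`, every colour `k`,
  `|(W(x,y)(G_k(Ω,A)f)(y) − (G_k(Ω,A)f)(x))_k| ≤ 2^{d+2}e^{19/8}(γ' + (1 + w)γ)·e^{−D/M}·φ`.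

HONEST SCOPE.  As in `B4Ineq110WalkRoute`: the sup inputs `γ, γ', β` are ASSUMED for every cube (no `R₀`; they are
Lemmas 2.1/2.2 at `Ã_j`, reserve item R9 at `A ≠ 0`); the Hölder member (1.9) is not treated; the constant carries the
colour row-norm `w` of the link variable because the `ℓ^∞` norm here runs over sites and colours (the print's `|φ(x)|`
is Euclidean in the colour index, for which orthogonal `U` cost nothing); the factor `η⁻¹` of `D^η` is carried by the
weights (dictionary of `B4GaugeCovariance`).  No `def`, no `Prop` fact, no `sorry`; axioms standard.
-/

namespace Literature.MathematicalPhysics.QuantumFieldTheory.Balaban1983to89.B4Ineq110WalkRouteDeriv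

open Literature.MathematicalPhysics.QuantumFieldTheory.Balaban1983to89.B4GaugeCovariance
open Literature.MathematicalPhysics.QuantumFieldTheory.Balaban1983to89.B4Commutators25to211
open Literature.MathematicalPhysics.QuantumFieldTheory.Balaban1983to89.B4PartitionUnity22
open Literature.MathematicalPhysics.QuantumFieldTheory.Balaban1983to89.B4RandomWalk213
open Literature.MathematicalPhysics.QuantumFieldTheory.Balaban1983to89.B4Eq26Locality
open Literature.MathematicalPhysics.QuantumFieldTheory.Balaban1983to89.B4Eq213ConcreteWalk
open Literature.MathematicalPhysics.QuantumFieldTheory.Balaban1983to89.B4Eq212SmallR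
open Literature.MathematicalPhysics.QuantumFieldTheory.Balaban1983to89.B4Ineq110WalkRoute
open scoped Matrix NNReal

open scoped Matrix.Norms.Operator

/-! ## §1. Norm plumbing (rows, `A·f`) -/

section Norm

variable {m n : Type*} [Fintype m] [Fintype n]

/-- a row sum is at most the `ℓ^∞`-operator norm. [folklore] -/
private theorem row_sum_le_norm (A : Matrix m n ℝ) (i : m) : ∑ j, |A i j| ≤ ‖A‖ := by
  rw [Matrix.linfty_opNorm_def]
  have h : (∑ j, ‖A i j‖₊ : ℝ≥0) ≤ Finset.univ.sup fun i => ∑ j, ‖A i j‖₊ :=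
    Finset.le_sup (f := fun i => ∑ j, ‖A i j‖₊) (Finset.mem_univ i)
  have h' := NNReal.coe_le_coe.mpr h
  simp only [NNReal.coe_sum, coe_nnnorm, Real.norm_eq_abs] at h'
  exact h'

/-- the `ℓ^∞`-operator norm is bounded by any common bound of the row sums. [folklore] -/
private theorem norm_le_of_rows (A : Matrix m n ℝ) {C : ℝ} (hC : 0 ≤ C) (h : ∀ i, ∑ j, |A i j| ≤ C) :
    ‖A‖ ≤ C := by
  rw [Matrix.linfty_opNorm_def]
  have : (Finset.univ.sup fun i => ∑ j, ‖A i j‖₊ : ℝ≥0) ≤ C.toNNReal := by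
    refine Finset.sup_le fun i _ => ?_
    rw [← NNReal.coe_le_coe, Real.coe_toNNReal C hC]
    simp only [NNReal.coe_sum, coe_nnnorm, Real.norm_eq_abs]
    exact h i
  have h2 := NNReal.coe_le_coe.mpr this
  rwa [Real.coe_toNNReal C hC] at h2

/-- `|(Af)_i| ≤ ‖A‖·sup|f|`. [folklore] -/
private theorem abs_mulVec_le (A : Matrix m n ℝ) (f : n → ℝ) {φ : ℝ} (hφ : 0 ≤ φ) (hf : ∀ j, |f j| ≤ φ)
    (i : m) : |(A *ᵥ f) i| ≤ ‖A‖ * φ := by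
  rw [Matrix.mulVec, dotProduct]
  calc |∑ j, A i j * f j| ≤ ∑ j, |A i j * f j| := Finset.abs_sum_le_sum_abs _ _
    _ ≤ ∑ j, |A i j| * φ := Finset.sum_le_sum fun j _ => by
        rw [abs_mul]; exact mul_le_mul_of_nonneg_left (hf j) (abs_nonneg _)
    _ = (∑ j, |A i j|) * φ := by rw [Finset.sum_mul]
    _ ≤ ‖A‖ * φ := mul_le_mul_of_nonneg_right (row_sum_le_norm A i) hφ

end Norm

/-! ## §2. The bond-difference operator `D_b` of (1.3) placed at the site `x`: `P_b = E_{xy}[W(x,y)] − E_{xx}[1]` -/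

section Bond

variable {X κ : Type*} [Fintype X] [Fintype κ] [DecidableEq X] [DecidableEq κ]

omit [Fintype X] [Fintype κ] [DecidableEq κ] in
/-- the entries of the block matrix unit `E_{xy}[B]`. [cite: Balaban1983RegularityDecay, (1.3) p.572] -/
theorem unitOp_apply (x y : X) (B : Matrix κ κ ℝ) (p p' : X × κ) :
    unitOp x y B p p' = if p.1 = x ∧ p'.1 = y then B p.2 p'.2 else 0 := by
  unfold unitOp
  rw [blockOp_apply]
  split_ifs <;> rfl

omit [Fintype κ] [DecidableEq κ] in
/-- `E_{xy}[B] · h = h(y)·E_{xy}[B]` (right multiplication by `h` scales the column block `y`).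
[cite: Balaban1983RegularityDecay, (2.2)–(2.5) pp. 575–576] -/
theorem unitOp_mul_mulH [Fintype κ] [DecidableEq κ] (x y : X) (B : Matrix κ κ ℝ) (h : X → ℝ) :
    unitOp x y B * mulH (ι := κ) h = h y • unitOp x y B := by
  unfold unitOp
  rw [blockOp_mul_mulH, ← blockOp_smul]
  congr 1
  funext z z'
  by_cases hz : z = x ∧ z' = y
  · simp only [hz, and_self, if_true, Pi.smul_apply]
  · simp only [hz, if_false, smul_zero, Pi.smul_apply]

/-- `‖E_{xy}[B]‖ ≤ w` when every row of `B` has `ℓ¹`-norm `≤ w`. [cite: Balaban1983RegularityDecay, (2.20) p.578] -/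
theorem norm_unitOp_le (x y : X) (B : Matrix κ κ ℝ) {w : ℝ} (hw0 : 0 ≤ w) (hw : ∀ k, ∑ k', |B k k'| ≤ w) :
    ‖unitOp x y B‖ ≤ w := by
  refine norm_le_of_rows _ hw0 fun p => ?_
  by_cases hp : p.1 = x
  · calc ∑ p', |unitOp x y B p p'| = ∑ p' : X × κ, if p'.1 = y then |B p.2 p'.2| else 0 := by
          refine Finset.sum_congr rfl fun p' _ => ?_
          rw [unitOp_apply]
          by_cases h' : p'.1 = y
          · rw [if_pos ⟨hp, h'⟩, if_pos h']
          · rw [if_neg (fun h => h' h.2), if_neg h', abs_zero]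
      _ = ∑ k', |B p.2 k'| := by
          rw [Fintype.sum_prod_type]
          simp only [Finset.sum_ite_irrel, Finset.sum_const_zero, Finset.sum_ite_eq', Finset.mem_univ, if_true]
      _ ≤ w := hw p.2
  · have : ∀ p', |unitOp x y B p p'| = 0 := fun p' => by
      rw [unitOp_apply, if_neg (fun h => hp h.1), abs_zero]
    simp only [this, Finset.sum_const_zero]
    exact hw0

/-- **THE COVARIANT BOND DIFFERENCE OF (1.3) AT THE SITE `x`**: `P_b = E_{xy}[W(x,y)] − E_{xx}[1]`, the square operator
whose `x`-block row computes `W(x,y)φ(y) − φ(x) = (D^η_Aφ)(b)` (up to the factor `η⁻¹` carried by the weights) and whose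
other rows vanish. [cite: Balaban1983RegularityDecay, (1.3) p.572, (1.10) p.573] -/
theorem fld_bondOp_mulVec (x y : X) (W : X → X → Matrix κ κ ℝ) (Φ : X × κ → ℝ) :
    fld ((unitOp x y (W x y) - unitOp x x 1) *ᵥ Φ) x = W x y *ᵥ fld Φ y - fld Φ x := by
  rw [unitOp, unitOp, ← blockOp_sub, fld_blockOp_mulVec]
  simp only [Pi.sub_apply, true_and, Matrix.sub_mulVec, Finset.sum_sub_distrib]
  rw [Finset.sum_eq_single y, Finset.sum_eq_single x]
  · simp
  · intro z _ hz; simp [hz]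
  · intro h; exact absurd (Finset.mem_univ x) h
  · intro z _ hz; simp [hz]
  · intro h; exact absurd (Finset.mem_univ y) h

end Bond

/-! ## §3. THEOREM (1.10), DERIVATIVE member, by the walk route -/

section Route

variable {X Y κ : Type*} [Fintype X] [Fintype Y] [Fintype κ] [DecidableEq X] [DecidableEq κ] {d : ℕ}

/-- the labels that can see the site `x` number at most `2^d`. [cite: Balaban1983RegularityDecay, §2 p.575] -/
private theorem card_labelBox_le (M : ℝ) (x : Fin d → ℝ) :
    (Fintype.piFinset fun μ => ({⌊x μ / M⌋, ⌊x μ / M⌋ + 1} : Finset ℤ)).card ≤ 2 ^ d := by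
  rw [Fintype.card_piFinset]
  calc ∏ μ, ({⌊x μ / M⌋, ⌊x μ / M⌋ + 1} : Finset ℤ).card ≤ 2 ^ (Finset.univ : Finset (Fin d)).card :=
        Finset.prod_le_pow_card _ _ 2 fun μ _ => Finset.card_le_two
    _ = 2 ^ d := by rw [Finset.card_univ, Fintype.card_fin]

/-- `e⁻¹ ≤ 1/2`. [folklore] -/
private theorem exp_neg_one_le_half : Real.exp (-1) ≤ 1 / 2 := by
  have h := Real.add_one_le_exp (1 : ℝ)
  rw [Real.exp_neg, inv_eq_one_div]
  exact one_div_le_one_div_of_le (by norm_num) (by linarith)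

/-- **THEOREM (1.10), DERIVATIVE MEMBER, FOR `G_k(Ω,A)` — the §2 walk route end to end on the concrete operators, for
EVERY finite region and EVERY configuration, with the per-cube inputs explicit**: `γ ≥ ‖G_j‖`, `γ' ≥ ‖P_bG_j‖` (Lemma 2.2
(2.17) at `p = q = ∞` for the values and the covariant derivatives of the cube propagators), `β ≥ ‖K_jG_jh_j‖` with the
choice (2.21) `3^dβ ≤ e⁻¹`, and `w ≥` the row sums of `|W(x,y)|` (`= 1` for `N = 1`; `≤ √N` for orthogonal `W`).  For the
bond `b = ⟨x, y⟩` (`|x − y|_∞ ≤ M/8`, a weighted bond of (1.3)), every site set `F` and every `D ≤ dist_∞(x, F)`: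
`‖P_b · G_k(Ω,A) · 1_F‖ ≤ 2^{d+2}e^{19/8}(γ' + (1 + w)γ)·e^{−D/M}`, i.e. «|(D^η_{A,μ}G_k(Ω,A)f)(x)| ≤
c₀e^{−δ₀dist(x,supp f)}‖f‖_∞» with `δ₀ = M⁻¹`.  Far from `F` this is the walk bound with `P = P_b` (at most `2^{d+1}` starting
cubes — those seeing `x` or `y` —, `‖P_b·h_jG_jh_j‖ ≤ γ' + wγ` by `P_b·h_j = h_j(x)P_b + (h_j(y) − h_j(x))E_{xy}[W]`,
separation `⌊D/M − 11/8⌋`); near `F` it is `‖P_b‖‖G‖ ≤ (1 + w)2^{d+1}γ`.  HONEST SCOPE as in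
`B4Ineq110WalkRoute.ineq110_value` (sup inputs assumed for every cube; no `R₀`); the constant carries `w` because the
`ℓ^∞` norm here is taken over sites AND colours (the print's `|φ(x)|` is Euclidean in the colour index).
[cite: Balaban1983RegularityDecay, Theorem (1.10) p.573; (2.13) p.577; (2.20)–(2.22) pp.578–579] -/
theorem ineq110_deriv {M : ℝ} (hM : 0 < M) (pos : X → Fin d → ℝ) (c : X → X → ℝ) (m2 a : ℝ)
    (q : Y → X → ℝ) (W : X → X → Matrix κ κ ℝ) (T : Y → X → Matrix κ κ ℝ)
    (hc : ∀ x z', c x z' ≠ 0 → ∀ μ, |pos x μ - pos z' μ| ≤ 1 / 8 * M)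
    (hq : ∀ y x z', q y x ≠ 0 → q y z' ≠ 0 → ∀ μ, |pos x μ - pos z' μ| ≤ 1 / 8 * M)
    (s : Finset (Fin d → ℤ)) (hs : ∀ j x, hCube M j (pos x) ≠ 0 → j ∈ s)
    (S : (Fin d → ℤ) → X → Prop) [∀ j, DecidablePred (S j)]
    (hS : ∀ j z, (∀ μ, |pos z μ - M * j μ| ≤ 7 / 8 * M) → S j z)
    (W' : (Fin d → ℤ) → X → X → Matrix κ κ ℝ) (T' : (Fin d → ℤ) → Y → X → Matrix κ κ ℝ)
    (hWW' : ∀ j x z', (∀ μ, |pos x μ - M * j μ| ≤ 3 / 4 * M) → (∀ μ, |pos z' μ - M * j μ| ≤ 3 / 4 * M) →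
      W' j x z' = W x z')
    (hTT' : ∀ j y x, q y x ≠ 0 → (∀ μ, |pos x μ - M * j μ| ≤ 3 / 4 * M) → T' j y x = T y x)
    (Gj : (Fin d → ℤ) → Matrix (X × κ) (X × κ) ℝ)
    (hGj : ∀ j ∈ s, covOp (fun z z' => if (S j z ↔ S j z') then c z z' else 0) m2 a q (W' j) (T' j) * Gj j = 1)
    (G : Matrix (X × κ) (X × κ) ℝ) (hGH : G * covOp c m2 a q W T = 1)
    -- the bond
    (x y : X) (hxy : ∀ μ, |pos x μ - pos y μ| ≤ 1 / 8 * M) {w : ℝ} (hw0 : 0 ≤ w)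
    (hw : ∀ k, ∑ k', |W x y k k'| ≤ w)
    -- the analytic inputs
    {γ γ' β : ℝ} (hγ0 : 0 ≤ γ) (hγ : ∀ i : ↥s, ‖Gj i.1‖ ≤ γ) (hγ'0 : 0 ≤ γ')
    (hγ' : ∀ i : ↥s, ‖(unitOp x y (W x y) - unitOp x x 1) * Gj i.1‖ ≤ γ') (hβ0 : 0 ≤ β)
    (hβ : ∀ i : ↥s, ‖opK (fun z z' => if (S i.1 z ↔ S i.1 z') then c z z' else 0) m2 a q (W' i.1) (T' i.1)
        (fun z => hCube M i.1 (pos z)) * Gj i.1 * mulH (ι := κ) (fun z => hCube M i.1 (pos z))‖ ≤ β)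
    (h3β : (3 : ℝ) ^ d * β ≤ Real.exp (-1))
    -- the support set and its separation from `x`
    (F : X → Prop) [DecidablePred F] {D : ℝ} (hD : ∀ x', F x' → ∃ μ, D ≤ |pos x μ - pos x' μ|) :
    ‖(unitOp x y (W x y) - unitOp x x 1) * G * mulH (ι := κ) (fun z => if F z then (1 : ℝ) else 0)‖
      ≤ 2 ^ (d + 2) * Real.exp (19 / 8) * (γ' + (1 + w) * γ) * Real.exp (-(D / M)) := by
  classical
  -- the letters
  set h : (Fin d → ℤ) → X → ℝ := fun j z => hCube M j (pos z) with hh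
  set cut : (Fin d → ℤ) → X → X → ℝ := fun j z z' => if (S j z ↔ S j z') then c z z' else 0 with hcut
  set aJ : (Fin d → ℤ) → Matrix (X × κ) (X × κ) ℝ :=
    fun j => mulH (ι := κ) (h j) * Gj j * mulH (ι := κ) (h j) with haJ
  set bJ : (Fin d → ℤ) → Matrix (X × κ) (X × κ) ℝ :=
    fun j => opK (cut j) m2 a q (W' j) (T' j) (h j) * Gj j * mulH (ι := κ) (h j) with hbJ
  set Pb : Matrix (X × κ) (X × κ) ℝ := unitOp x y (W x y) - unitOp x x 1 with hPbdef
  set P' : Matrix (X × κ) (X × κ) ℝ := mulH (ι := κ) (fun z => if F z then (1 : ℝ) else 0) with hP'def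
  -- sizes of the letters
  have hh0 : ∀ j z, 0 ≤ h j z := fun j z => hCube_nonneg M j (pos z)
  have hhle : ∀ j z, h j z ≤ 1 := fun j z => hCube_le_one M j (pos z)
  have hh1 : ∀ j z, |h j z| ≤ 1 := fun j z => abs_le.mpr ⟨by linarith [hh0 j z], hhle j z⟩
  have hnH : ∀ j, ‖mulH (ι := κ) (h j)‖ ≤ 1 := fun j => norm_mulH_le _ zero_le_one (hh1 j)
  have hnP' : ‖P'‖ ≤ 1 := norm_mulH_le _ zero_le_one fun z => by
    by_cases hz : F z <;> simp [hz]
  have hnUW : ‖unitOp x y (W x y)‖ ≤ w := norm_unitOp_le x y _ hw0 hw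
  have hnU1 : ‖unitOp (ι := κ) x x 1‖ ≤ 1 := norm_unitOp_le x x _ zero_le_one fun k => by
    rw [Finset.sum_eq_single k]
    · simp
    · intro k' _ hk'; rw [Matrix.one_apply_ne' hk', abs_zero]
    · intro hk; exact absurd (Finset.mem_univ k) hk
  have hnPb : ‖Pb‖ ≤ w + 1 := (norm_sub_le _ _).trans (add_le_add hnUW hnU1)
  have hnA : ∀ j : ↥s, ‖aJ j.1‖ ≤ γ := by
    intro j
    calc ‖aJ j.1‖ ≤ ‖mulH (ι := κ) (h j.1) * Gj j.1‖ * ‖mulH (ι := κ) (h j.1)‖ := norm_mul_le _ _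
      _ ≤ (‖mulH (ι := κ) (h j.1)‖ * ‖Gj j.1‖) * ‖mulH (ι := κ) (h j.1)‖ :=
          mul_le_mul_of_nonneg_right (norm_mul_le _ _) (norm_nonneg _)
      _ ≤ (1 * γ) * 1 :=
          mul_le_mul (mul_le_mul (hnH j.1) (hγ j) (norm_nonneg _) zero_le_one) (hnH j.1) (norm_nonneg _)
            (by rw [one_mul]; exact hγ0)
      _ = γ := by ring
  -- `P_b·h_j = h_j(x)P_b + (h_j(y) − h_j(x))E_{xy}[W]`
  have hPbH : ∀ j, Pb * mulH (ι := κ) (h j) = h j x • Pb + (h j y - h j x) • unitOp x y (W x y) := by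
    intro j
    simp only [hPbdef, Matrix.sub_mul, unitOp_mul_mulH, smul_sub, sub_smul]
    abel
  have hnPa : ∀ j : ↥s, ‖Pb * aJ j.1‖ ≤ γ' + w * γ := by
    intro j
    have hsplit : Pb * aJ j.1 = h j.1 x • (Pb * Gj j.1 * mulH (ι := κ) (h j.1))
        + (h j.1 y - h j.1 x) • (unitOp x y (W x y) * Gj j.1 * mulH (ι := κ) (h j.1)) := by
      simp only [haJ]
      rw [← Matrix.mul_assoc, ← Matrix.mul_assoc, hPbH j.1, Matrix.add_mul, Matrix.add_mul, Matrix.smul_mul,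
        Matrix.smul_mul, Matrix.smul_mul, Matrix.smul_mul]
    have hdiff : |h j.1 y - h j.1 x| ≤ 1 := by
      rw [abs_le]; constructor <;> linarith [hh0 j.1 y, hhle j.1 y, hh0 j.1 x, hhle j.1 x]
    rw [hsplit]
    calc ‖h j.1 x • (Pb * Gj j.1 * mulH (ι := κ) (h j.1))
          + (h j.1 y - h j.1 x) • (unitOp x y (W x y) * Gj j.1 * mulH (ι := κ) (h j.1))‖
        ≤ ‖h j.1 x • (Pb * Gj j.1 * mulH (ι := κ) (h j.1))‖
          + ‖(h j.1 y - h j.1 x) • (unitOp x y (W x y) * Gj j.1 * mulH (ι := κ) (h j.1))‖ := norm_add_le _ _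
      _ ≤ 1 * (γ' * 1) + 1 * ((w * γ) * 1) := by
          rw [norm_smul, norm_smul, Real.norm_eq_abs, Real.norm_eq_abs]
          refine add_le_add (mul_le_mul (hh1 j.1 x) ?_ (norm_nonneg _) zero_le_one)
            (mul_le_mul hdiff ?_ (norm_nonneg _) zero_le_one)
          · exact (norm_mul_le _ _).trans (mul_le_mul (hγ' j) (hnH j.1) (norm_nonneg _) hγ'0)
          · exact (norm_mul_le _ _).trans (mul_le_mul ((norm_mul_le _ _).trans
              (mul_le_mul hnUW (hγ j) (norm_nonneg _) hw0)) (hnH j.1) (norm_nonneg _) (mul_nonneg hw0 hγ0))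
      _ = γ' + w * γ := by ring
  -- `‖R‖ ≤ 1/2`, `G(1 − R) = G₀`, `‖G‖ ≤ 2^{d+1}γ` (as in the value member)
  have hR2 : ‖∑ j ∈ s, bJ j‖ ≤ (2 : ℝ) ^ d * β := norm_R_le hM pos c m2 a q hc hq s S W' T' Gj hβ0 hβ
  have h23 : (2 : ℝ) ^ d * β ≤ (3 : ℝ) ^ d * β :=
    mul_le_mul_of_nonneg_right (pow_le_pow_left₀ (by norm_num) (by norm_num) d) hβ0
  have hRhalf : ‖∑ j ∈ s, bJ j‖ ≤ 1 / 2 := (hR2.trans h23).trans (h3β.trans exp_neg_one_le_half)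
  have hRlt : ‖∑ j ∈ s, bJ j‖ < 1 := hRhalf.trans_lt (by norm_num)
  have h211 : covOp c m2 a q W T * ∑ j ∈ s, aJ j = 1 - ∑ j ∈ s, bJ j :=
    parametrix_identity_hCube hM pos c m2 a q W T s hs S hS hc hq W' T' hWW' hTT' Gj hGj
  have hGeq : G * (1 - ∑ j ∈ s, bJ j) = ∑ j ∈ s, aJ j := G_mul_one_sub_eq hGH h211
  have hG0 : ‖∑ j ∈ s, aJ j‖ ≤ (2 : ℝ) ^ d * γ := by
    have hmain := norm_sum_le_of_rowMult s aJ hγ0 (fun l hl => hnA ⟨l, hl⟩)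
      (fun i : X × κ => Fintype.piFinset fun μ => ({⌊pos i.1 μ / M⌋, ⌊pos i.1 μ / M⌋ + 1} : Finset ℤ))
      (m₀ := 2 ^ d) (fun i => card_labelBox_le M (pos i.1))
      (by
        rintro ⟨z, k⟩ l _ hln p
        have hlz : h l z = 0 := by
          by_contra hne
          exact hln (mem_box_of_hCube_ne_zero hne)
        simp only [haJ]
        rw [Matrix.mul_assoc, mulH_mul_apply, hlz, zero_mul])
    exact_mod_cast hmain
  have hG : ‖G‖ ≤ (2 : ℝ) ^ (d + 1) * γ := by
    have h1 := norm_le_of_neumann hRlt hGeq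
    have hinv : (1 - ‖∑ j ∈ s, bJ j‖)⁻¹ ≤ 2 := (inv_le_comm₀ (by linarith) two_pos).mpr (by linarith)
    calc ‖G‖ ≤ ‖∑ j ∈ s, aJ j‖ * (1 - ‖∑ j ∈ s, bJ j‖)⁻¹ := h1
      _ ≤ ((2 : ℝ) ^ d * γ) * 2 :=
          mul_le_mul hG0 hinv (inv_nonneg.mpr (by linarith)) (by positivity)
      _ = (2 : ℝ) ^ (d + 1) * γ := by ring
  -- the exponent bookkeeping
  have hexp : Real.exp (-1) * (2 * Real.exp 2 * Real.exp (-(D / M - 11 / 8)))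
      = 2 * Real.exp (19 / 8) * Real.exp (-(D / M)) := by
    rw [show (19 / 8 : ℝ) = -1 + 2 + 11 / 8 by norm_num, Real.exp_add, Real.exp_add,
      show -(D / M - 11 / 8) = 11 / 8 + -(D / M) by ring, Real.exp_add]
    ring
  have hKpos : 0 ≤ γ' + (1 + w) * γ := by positivity
  by_cases hfar : 1 ≤ ⌊D / M - 11 / 8⌋₊
  · -- FAR FROM THE SUPPORT
    set N : ℕ := ⌊D / M - 11 / 8⌋₊ with hNdef
    have hDM : 1 ≤ D / M - 11 / 8 := by
      by_contra hlt
      rw [not_le] at hlt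
      have : N = 0 := Nat.floor_eq_zero.mpr hlt
      omega
    have hNle : (N : ℝ) ≤ D / M - 11 / 8 := Nat.floor_le (by linarith)
    have hNlt : D / M - 11 / 8 < N + 1 := Nat.lt_floor_add_one _
    have hND : ((N : ℝ) + 11 / 8) * M ≤ D := by
      have : (N : ℝ) + 11 / 8 ≤ D / M := by linarith
      rwa [le_div_iff₀ hM] at this
    set S₀ : Finset ↥s := Finset.univ.filter fun i : ↥s => h i.1 x ≠ 0 ∨ h i.1 y ≠ 0 with hS₀
    set S₁ : Finset ↥s := Finset.univ.filter fun i : ↥s => ∃ x', F x' ∧ h i.1 x' ≠ 0 with hS₁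
    have hP : ∀ i : ↥s, i ∉ S₀ → Pb * aJ i.1 = 0 := by
      intro i hi
      have hix : h i.1 x = 0 := by
        by_contra hne
        exact hi (Finset.mem_filter.mpr ⟨Finset.mem_univ _, Or.inl hne⟩)
      have hiy : h i.1 y = 0 := by
        by_contra hne
        exact hi (Finset.mem_filter.mpr ⟨Finset.mem_univ _, Or.inr hne⟩)
      have hzero : Pb * mulH (ι := κ) (h i.1) = 0 := by
        rw [hPbH i.1, hix, hiy, sub_zero, zero_smul, zero_smul, add_zero]
      simp only [haJ]
      rw [← Matrix.mul_assoc, ← Matrix.mul_assoc, hzero, Matrix.zero_mul, Matrix.zero_mul]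
    have hF0 : ∀ i : ↥s, i ∉ S₁ → mulH (ι := κ) (h i.1) * P' = 0 := by
      intro i hi
      rw [hP'def, mulH_mul_mulH]
      refine mulH_eq_zero_of fun z => ?_
      by_cases hz : F z
      · have hiz : h i.1 z = 0 := by
          by_contra hne
          exact hi (Finset.mem_filter.mpr ⟨Finset.mem_univ _, z, hz, hne⟩)
        rw [hiz, zero_mul]
      · rw [if_neg hz, mul_zero]
    have hP'a : ∀ i : ↥s, i ∉ S₁ → aJ i.1 * P' = 0 := by
      intro i hi
      simp only [haJ]
      rw [Matrix.mul_assoc, hF0 i hi, Matrix.mul_zero]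
    have hP'b : ∀ i : ↥s, i ∉ S₁ → bJ i.1 * P' = 0 := by
      intro i hi
      simp only [hbJ]
      rw [Matrix.mul_assoc, hF0 i hi, Matrix.mul_zero]
    have hβ₁ : ∀ i : ↥s, ‖bJ i.1 * P'‖ ≤ β := fun i =>
      (norm_mul_le _ _).trans (by
        calc ‖bJ i.1‖ * ‖P'‖ ≤ β * 1 := mul_le_mul (hβ i) hnP' (norm_nonneg _) hβ0
          _ = β := mul_one β)
    have hsep : ∀ i ∈ S₀, ∀ l ∈ S₁, ∃ μ, (N : ℤ) ≤ |i.1 μ - l.1 μ| := by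
      intro i hi l hl
      obtain ⟨-, hixy⟩ := Finset.mem_filter.mp hi
      obtain ⟨-, x', hFx', hlx'⟩ := Finset.mem_filter.mp hl
      obtain ⟨μ, hμ⟩ := hD x' hFx'
      refine ⟨μ, ?_⟩
      -- `i` sees `x` or `y`, and `y` is within `M/8` of `x`: `|x − Mi| < (3/4)M`
      have h1 : |pos x μ - M * i.1 μ| < 3 / 4 * M := by
        rcases hixy with hix | hiy
        · exact (hCube_ne_zero_imp hM hix μ).trans (by nlinarith)
        · calc |pos x μ - M * i.1 μ| = |(pos x μ - pos y μ) + (pos y μ - M * i.1 μ)| := by ring_nf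
            _ ≤ |pos x μ - pos y μ| + |pos y μ - M * i.1 μ| := abs_add_le _ _
            _ < 1 / 8 * M + 5 / 8 * M := add_lt_add_of_le_of_lt (hxy μ) (hCube_ne_zero_imp hM hiy μ)
            _ = 3 / 4 * M := by ring
      have h2 : |pos x' μ - M * l.1 μ| < 5 / 8 * M := hCube_ne_zero_imp hM hlx' μ
      have h3 : ((N : ℝ) + 11 / 8) * M ≤ |pos x μ - pos x' μ| := hND.trans hμ
      have htri : |pos x μ - pos x' μ|
          ≤ |pos x μ - M * i.1 μ| + |M * i.1 μ - M * l.1 μ| + |pos x' μ - M * l.1 μ| := by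
        calc |pos x μ - pos x' μ|
            = |(pos x μ - M * i.1 μ) + (M * i.1 μ - M * l.1 μ) + (M * l.1 μ - pos x' μ)| := by ring_nf
          _ ≤ |pos x μ - M * i.1 μ| + |M * i.1 μ - M * l.1 μ| + |M * l.1 μ - pos x' μ| := abs_add_three _ _ _
          _ = _ := by rw [abs_sub_comm (M * l.1 μ) (pos x' μ)]
      have h4 : (N : ℝ) * M < |M * i.1 μ - M * l.1 μ| := by linarith
      rw [← mul_sub, abs_mul, abs_of_pos hM] at h4
      have h5 : (N : ℝ) < |((i.1 μ : ℤ) : ℝ) - l.1 μ| := lt_of_mul_lt_mul_right (by linarith) hM.le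
      have h6 : ((N : ℤ) : ℝ) < (|i.1 μ - l.1 μ| : ℤ) := by push_cast; exact h5
      exact (Int.cast_lt.mp h6).le
    have hcardS₀ : S₀.card ≤ 2 ^ (d + 1) := by
      have hsub : S₀.map (Function.Embedding.subtype (· ∈ s))
          ⊆ (Fintype.piFinset fun μ => ({⌊pos x μ / M⌋, ⌊pos x μ / M⌋ + 1} : Finset ℤ))
            ∪ (Fintype.piFinset fun μ => ({⌊pos y μ / M⌋, ⌊pos y μ / M⌋ + 1} : Finset ℤ)) := by
        intro j hj
        obtain ⟨i, hi, rfl⟩ := Finset.mem_map.mp hj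
        obtain ⟨-, hixy⟩ := Finset.mem_filter.mp hi
        rcases hixy with hix | hiy
        · exact Finset.mem_union_left _ (mem_box_of_hCube_ne_zero hix)
        · exact Finset.mem_union_right _ (mem_box_of_hCube_ne_zero hiy)
      calc S₀.card = (S₀.map (Function.Embedding.subtype (· ∈ s))).card := (Finset.card_map _).symm
        _ ≤ _ := Finset.card_le_card hsub
        _ ≤ _ := Finset.card_union_le _ _
        _ ≤ 2 ^ d + 2 ^ d := add_le_add (card_labelBox_le M (pos x)) (card_labelBox_le M (pos y))
        _ = 2 ^ (d + 1) := by ring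
    have hr : ((N : ℝ) + 1) - 2 ≤ ((N - 1 : ℕ) : ℝ) := by
      rw [Nat.cast_sub hfar, Nat.cast_one]; linarith
    have hα0 : 0 ≤ γ' + w * γ := by positivity
    have hwalk := concrete_walk_decay_exp hM pos c m2 a q W T hc hq s hs S hS W' T' hWW' hTT' Gj hGj G hGH
      (P := Pb) (P' := P') (S₀ := S₀) (S₁ := S₁) (α := γ' + w * γ) (β := β) (β₁ := β) (N := N)
      hP hP'a hP'b hnPa hβ0 hβ hβ₁ h3β hfar hsep hr
    have hEN : Real.exp (-((N : ℝ) + 1)) ≤ Real.exp (-(D / M - 11 / 8)) := Real.exp_le_exp.mpr (by linarith)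
    calc ‖Pb * G * P'‖
        ≤ S₀.card * (γ' + w * γ) * β * (3 : ℝ) ^ d * (2 * Real.exp 2 * Real.exp (-((N : ℝ) + 1))) := hwalk
      _ ≤ (2 : ℝ) ^ (d + 1) * (γ' + (1 + w) * γ) * β * (3 : ℝ) ^ d
            * (2 * Real.exp 2 * Real.exp (-(D / M - 11 / 8))) := by
          gcongr
          · exact_mod_cast hcardS₀
          · linarith
      _ = (2 : ℝ) ^ (d + 1) * (γ' + (1 + w) * γ)
            * (((3 : ℝ) ^ d * β) * (2 * Real.exp 2 * Real.exp (-(D / M - 11 / 8)))) := by ring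
      _ ≤ (2 : ℝ) ^ (d + 1) * (γ' + (1 + w) * γ)
            * (Real.exp (-1) * (2 * Real.exp 2 * Real.exp (-(D / M - 11 / 8)))) := by gcongr
      _ = 2 ^ (d + 2) * Real.exp (19 / 8) * (γ' + (1 + w) * γ) * Real.exp (-(D / M)) := by rw [hexp]; ring
  · -- NEAR THE SUPPORT (`D < (19/8)M`)
    rw [not_le, Nat.lt_one_iff, Nat.floor_eq_zero] at hfar
    have hE : 1 ≤ Real.exp (19 / 8) * Real.exp (-(D / M)) := by
      rw [← Real.exp_add]
      exact Real.one_le_exp_iff.mpr (by linarith)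
    calc ‖Pb * G * P'‖ ≤ ‖Pb * G‖ * ‖P'‖ := norm_mul_le _ _
      _ ≤ (‖Pb‖ * ‖G‖) * ‖P'‖ := mul_le_mul_of_nonneg_right (norm_mul_le _ _) (norm_nonneg _)
      _ ≤ ((w + 1) * ((2 : ℝ) ^ (d + 1) * γ)) * 1 :=
          mul_le_mul (mul_le_mul hnPb hG (norm_nonneg _) (by positivity)) hnP' (norm_nonneg _)
            (mul_nonneg (by positivity) (mul_nonneg (by positivity) hγ0))
      _ ≤ (2 : ℝ) ^ (d + 2) * (γ' + (1 + w) * γ) * 1 := by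
          have hA : 0 ≤ (2 : ℝ) ^ (d + 1) := by positivity
          have h1 : 0 ≤ (2 : ℝ) ^ (d + 1) * γ' := mul_nonneg hA hγ'0
          have h2 : 0 ≤ (2 : ℝ) ^ (d + 1) * ((1 + w) * γ) := mul_nonneg hA (mul_nonneg (by linarith) hγ0)
          have h3 : (w + 1) * ((2 : ℝ) ^ (d + 1) * γ) = (2 : ℝ) ^ (d + 1) * ((1 + w) * γ) := by ring
          have h4 : (2 : ℝ) ^ (d + 2) * (γ' + (1 + w) * γ)
              = 2 * ((2 : ℝ) ^ (d + 1) * γ') + 2 * ((2 : ℝ) ^ (d + 1) * ((1 + w) * γ)) := by ring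
          rw [mul_one, mul_one, h3, h4]
          linarith
      _ ≤ (2 : ℝ) ^ (d + 2) * (γ' + (1 + w) * γ) * (Real.exp (19 / 8) * Real.exp (-(D / M))) := by gcongr
      _ = 2 ^ (d + 2) * Real.exp (19 / 8) * (γ' + (1 + w) * γ) * Real.exp (-(D / M)) := by ring

/-- **(1.10) AS PRINTED, derivative member**: for `f` supported in `F` with `sup|f| ≤ φ` and `D ≤ dist_∞(x, F)`, every
colour component of the covariant bond difference of `G_k(Ω,A)f` over `b = ⟨x,y⟩` obeys
`|(W(x,y)(Gf)(y) − (Gf)(x))_k| ≤ 2^{d+2}e^{19/8}(γ' + (1 + w)γ)·e^{−D/M}·φ`. [cite: Balaban1983RegularityDecay, Theorem (1.10) p.573] -/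
theorem ineq110_deriv_apply {M : ℝ} (hM : 0 < M) (pos : X → Fin d → ℝ) (c : X → X → ℝ) (m2 a : ℝ)
    (q : Y → X → ℝ) (W : X → X → Matrix κ κ ℝ) (T : Y → X → Matrix κ κ ℝ)
    (hc : ∀ x z', c x z' ≠ 0 → ∀ μ, |pos x μ - pos z' μ| ≤ 1 / 8 * M)
    (hq : ∀ y x z', q y x ≠ 0 → q y z' ≠ 0 → ∀ μ, |pos x μ - pos z' μ| ≤ 1 / 8 * M)
    (s : Finset (Fin d → ℤ)) (hs : ∀ j x, hCube M j (pos x) ≠ 0 → j ∈ s)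
    (S : (Fin d → ℤ) → X → Prop) [∀ j, DecidablePred (S j)]
    (hS : ∀ j z, (∀ μ, |pos z μ - M * j μ| ≤ 7 / 8 * M) → S j z)
    (W' : (Fin d → ℤ) → X → X → Matrix κ κ ℝ) (T' : (Fin d → ℤ) → Y → X → Matrix κ κ ℝ)
    (hWW' : ∀ j x z', (∀ μ, |pos x μ - M * j μ| ≤ 3 / 4 * M) → (∀ μ, |pos z' μ - M * j μ| ≤ 3 / 4 * M) →
      W' j x z' = W x z')
    (hTT' : ∀ j y x, q y x ≠ 0 → (∀ μ, |pos x μ - M * j μ| ≤ 3 / 4 * M) → T' j y x = T y x)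
    (Gj : (Fin d → ℤ) → Matrix (X × κ) (X × κ) ℝ)
    (hGj : ∀ j ∈ s, covOp (fun z z' => if (S j z ↔ S j z') then c z z' else 0) m2 a q (W' j) (T' j) * Gj j = 1)
    (G : Matrix (X × κ) (X × κ) ℝ) (hGH : G * covOp c m2 a q W T = 1)
    (x y : X) (hxy : ∀ μ, |pos x μ - pos y μ| ≤ 1 / 8 * M) {w : ℝ} (hw0 : 0 ≤ w)
    (hw : ∀ k, ∑ k', |W x y k k'| ≤ w)
    {γ γ' β : ℝ} (hγ0 : 0 ≤ γ) (hγ : ∀ i : ↥s, ‖Gj i.1‖ ≤ γ) (hγ'0 : 0 ≤ γ')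
    (hγ' : ∀ i : ↥s, ‖(unitOp x y (W x y) - unitOp x x 1) * Gj i.1‖ ≤ γ') (hβ0 : 0 ≤ β)
    (hβ : ∀ i : ↥s, ‖opK (fun z z' => if (S i.1 z ↔ S i.1 z') then c z z' else 0) m2 a q (W' i.1) (T' i.1)
        (fun z => hCube M i.1 (pos z)) * Gj i.1 * mulH (ι := κ) (fun z => hCube M i.1 (pos z))‖ ≤ β)
    (h3β : (3 : ℝ) ^ d * β ≤ Real.exp (-1))
    (F : X → Prop) [DecidablePred F] {D : ℝ} (hD : ∀ x', F x' → ∃ μ, D ≤ |pos x μ - pos x' μ|)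
    (f : X × κ → ℝ) (hfF : ∀ p, ¬ F p.1 → f p = 0) {φ : ℝ} (hφ : 0 ≤ φ) (hf : ∀ p, |f p| ≤ φ) (k : κ) :
    |(W x y *ᵥ fld (G *ᵥ f) y - fld (G *ᵥ f) x) k|
      ≤ 2 ^ (d + 2) * Real.exp (19 / 8) * (γ' + (1 + w) * γ) * Real.exp (-(D / M)) * φ := by
  have hmain := ineq110_deriv hM pos c m2 a q W T hc hq s hs S hS W' T' hWW' hTT' Gj hGj G hGH x y hxy hw0 hw
    hγ0 hγ hγ'0 hγ' hβ0 hβ h3β F hD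
  have hP'f : mulH (ι := κ) (fun z => if F z then (1 : ℝ) else 0) *ᵥ f = f := by
    ext p
    rw [mulH_mulVec_apply]
    by_cases hz : F p.1
    · rw [if_pos hz, one_mul]
    · rw [if_neg hz, zero_mul, hfF p hz]
  have hentry : (((unitOp x y (W x y) - unitOp x x 1) * G
      * mulH (ι := κ) (fun z => if F z then (1 : ℝ) else 0)) *ᵥ f) (x, k)
      = (W x y *ᵥ fld (G *ᵥ f) y - fld (G *ᵥ f) x) k := by
    rw [← Matrix.mulVec_mulVec, ← Matrix.mulVec_mulVec, hP'f, ← fld_apply (((unitOp x y (W x y) - unitOp x x 1)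
      *ᵥ (G *ᵥ f))) x k, fld_bondOp_mulVec]
  rw [← hentry]
  exact (abs_mulVec_le _ f hφ hf (x, k)).trans (mul_le_mul_of_nonneg_right hmain hφ)

end Route

end Literature.MathematicalPhysics.QuantumFieldTheory.Balaban1983to89.B4Ineq110WalkRouteDeriv
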